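import Literature.NumberTheory.IwasawaTheory.FukudaElementaryLayerAlgebra
import HarnessLib

/-!
# The elementary-layer lemma in the «`Y₀ = TA`» shape: `#(M/TM) ≤ p` and `pM ⊄ ν_k T M` force `#(M/pM) ≤ p^{p^k − 1}`
# (the algebra of the elementary-layer door over a base with `ord_p h_K = 1` and maximal unit norm index)

Topic `NumberTheory/IwasawaTheory` (namespace `Literature.NumberTheory.IwasawaTheory.FukudaElementary`).  THEOREM-ONLY file (no definition,
no named fact, no instance, no `sorry`), written by the prover seat `bsd-line-att-p3` g47 (cell `bsd-f1-sign2`, route `AlignedTransportAtTwo`;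
`--supports` stmt-BirchSwinnertonDyer-22298, closes nothing; BSD is not advanced by this file).  Sequel of `FukudaElementaryLayer{Nakayama,Generator,Algebra}`
(same seat): there the layer modules were `A/ν_kA` (`Y₀ = A`, i.e. `p ∤ h_K`); when `ord_p h_K = 1` and the unit norm index is maximal one has instead
`Y₀ = TA` (`#A/Y₀ = p = #A/TA`), the layers are `A_k = A/ν_kTA`, and the SAME Nakayama argument runs with `ν_kT ≡ T^{p^k} (mod p)` in place of
`ν_k ≡ T^{p^k−1}` — with thresholds `p^k` in place of `p^k − 1` and no restriction on `k`.

* §1 `exists_generator_of_le` — the cyclic generator for ANY subgroup `V ⊆ 𝔪M = pM + TM` of index `≤ p`: `M = ℤ[φ]·x₀`, `p·x₀ ∈ V` (same proof as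
  `exists_generator`, which is the case `V = ν₁M`).
* §2 ★★ **`card_quotient_smul_le_of_card_quotient_sub_one_le`** — `M` a finite abelian `p`-group, `φ^{p^t} = 1`, `T = φ − 1`: **`#(M/TM) ≤ p` and
  `#(M/(ν_kTM + pM)) < #(M/ν_kTM)` (the layer-`k` quotient `M/ν_kTM` is NOT killed by `p`) ⟹ `#(M/pM) ≤ p^{p^k − 1}`** (`M = ℤ[φ]x₀`, `p x₀ ∈ TM`; climb
  `pM ⊆ T^jM` while `T^jM ⊄ pM`; `pM ⊆ T^{p^k}M ⊆ ν_kTM + T·pM` is excluded by Nakayama).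
* §3 `card_quotient_sup_sub_one_le_pow` — `#(M/TM) ≤ p ⟹ #(M/(ν_kTM + pM)) ≤ p^{p^k}` (the ranks are `≤ p^k`);
  ★ `card_quotient_smul_le_of_card_quotient_sup_lt_pow` — `#(M/TM) ≤ p` and `#(M/(ν_kTM + pM)) < p^{p^k}` ⟹ `#(M/pM) ≤ p^{p^k−1}` (the SMALL-RANK side with
  threshold `p^k` instead of L10's `p^k − 1`, because `Y₀ = TM` is known exactly; tree `MuZeroRank.card_quotient_smul_le_pow`).
So over such a layer module `μ > 0` would force `e_k = r_k = p^k` (`A_k ≅ (ℤ/p)^{p^k}`) at EVERY layer `k`.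

In `Λ = ℤ_p⟦T⟧`-terms (Washington §13.3, orientation only): `X = Λ/J` cyclic with `J + (T) = 𝔪`, `A_k = Λ/(J, ν_kT)`; `μ > 0` ⟺ `J = pΛ` ⟹ `A_k = 𝔽_p[T]/(T^{p^k})`.
Not found in print in this form (presearch as in the sibling files); ingredients cited at each use (D-0014).

References: [Washington1997] L. Washington, *Introduction to Cyclotomic Fields*, 2nd ed., §13.2 Lemma 13.16, §13.3 Lemmas 13.15, 13.18, Prop. 13.22–13.23;
[Fukuda1994] T. Fukuda, *Remarks on ℤ_p-extensions of number fields*, Proc. Japan Acad. 70 A (1994), Thm. 1 and its proof, p. 264; [Lang1990] Ch. 5 §1–§2.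
-/

set_option autoImplicit false

noncomputable section

open Polynomial Finset

namespace Literature.NumberTheory.IwasawaTheory.FukudaElementary

section Module

variable {M : Type*} [AddCommGroup M] {p : ℕ}

/-! ## §1 The cyclic generator for a subgroup `V ⊆ 𝔪M` of index `≤ p` -/

/-- ★ **THE CYCLIC GENERATOR, general form.**  `M` a finite abelian `p`-group, `φ^{p^t} = 1`, `V ⊆ pM + (φ−1)M` a subgroup with `#(M/V) ≤ p`: then
`M = ℤ[φ]·x₀` for some `x₀` with `p·x₀ ∈ V` (Nakayama; `V = 𝔪M` by counting unless `M = 0`).  The case `V = ν₁M` is `exists_generator`; the case `V = (φ−1)M` is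
the one used below. [cite: Washington1997, §13.2 Lemma 13.16, §13.3 Lemma 13.15] [cite: Fukuda1994, Thm. 1 (proof, p. 264)] -/
theorem exists_generator_of_le [Finite M] [hp : Fact p.Prime] (hM : ∃ a : ℕ, Nat.card M = p ^ a) (φ : Module.End ℤ M) {t : ℕ}
    (hφ : φ ^ p ^ t = 1) {V : Submodule ℤ M}
    (hVle : V ≤ (⊤ : Submodule ℤ M).map ((p : ℤ) • (1 : Module.End ℤ M)) ⊔ (⊤ : Submodule ℤ M).map (φ - 1))
    (h1 : Nat.card (M ⧸ V) ≤ p) :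
    ∃ x₀ : M, (∀ y : M, ∃ f : ℤ[X], aeval φ f x₀ = y) ∧ (p : ℤ) • x₀ ∈ V := by
  classical
  obtain ⟨a, ha⟩ := hM
  set π : Module.End ℤ M := (p : ℤ) • 1 with hπ
  set T : Module.End ℤ M := φ - 1 with hT
  set Q : Submodule ℤ M := (⊤ : Submodule ℤ M).map π ⊔ (⊤ : Submodule ℤ M).map T with hQ
  have hVQ : V ≤ Q := hVle
  have hQle : Nat.card (M ⧸ Q) ≤ p := (MuZeroRank.card_quotient_le_of_le hVQ).trans h1
  -- the evaluation map at a point and its range `ℤ[φ]·x`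
  have hrange : ∀ x : M, ∃ R₀ : Submodule ℤ M, (∀ y, y ∈ R₀ ↔ ∃ f : ℤ[X], aeval φ f x = y) ∧ (∀ y ∈ R₀, φ y ∈ R₀) := by
    intro x
    let ev : ℤ[X] →ₗ[ℤ] M := (LinearMap.applyₗ x).comp (aeval φ : ℤ[X] →ₐ[ℤ] Module.End ℤ M).toLinearMap
    have hev : ∀ f, ev f = aeval φ f x := fun f => rfl
    refine ⟨LinearMap.range ev, fun y => ?_, ?_⟩
    · rw [LinearMap.mem_range]
      exact ⟨fun ⟨f, hf⟩ => ⟨f, by rw [← hev]; exact hf⟩, fun ⟨f, hf⟩ => ⟨f, by rw [hev]; exact hf⟩⟩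
    · rintro _ ⟨f, rfl⟩
      refine ⟨X * f, ?_⟩
      rw [hev, hev, map_mul, aeval_X, Module.End.mul_apply]
  by_cases hQtop : Q = ⊤
  · -- `M = 𝔪M`, so `M = 0`
    have hM0 : (⊤ : Submodule ℤ M) ≤ ⊥ :=
      le_of_le_sup_smul_sup_sub_one ⟨a, ha⟩ φ hφ (N := ⊤) (S := ⊥) (fun _ _ => Submodule.mem_top)
        (fun x hx => by rw [(Submodule.mem_bot ℤ).mp hx, map_zero]; exact Submodule.zero_mem _)
        (by rw [bot_sup_eq, ← hQ, hQtop])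
    refine ⟨0, fun y => ⟨0, ?_⟩, by rw [smul_zero]; exact Submodule.zero_mem _⟩
    have hy : y = 0 := (Submodule.mem_bot ℤ).mp (hM0 (Submodule.mem_top (x := y)))
    subst hy; simp
  · -- `#(M/Q) = p` and any `x₀ ∉ Q` generates `M/Q`
    obtain ⟨x₀, hx₀⟩ : ∃ x₀ : M, x₀ ∉ Q := by
      by_contra hall
      push Not at hall
      exact hQtop (eq_top_iff.mpr fun x _ => hall x)
    haveI : Finite (M ⧸ Q) := Finite.of_surjective _ (Submodule.Quotient.mk_surjective _)
    have hcardQ : Nat.card (M ⧸ Q) = p := by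
      have hdvd : Nat.card (M ⧸ Q) ∣ p ^ a := by
        rw [← ha, Submodule.card_eq_card_quotient_mul_card Q]; exact Dvd.intro_left _ rfl
      obtain ⟨b, hb, hbeq⟩ := (Nat.dvd_prime_pow hp.out).mp hdvd
      rcases b with _ | b
      · exfalso
        rw [pow_zero] at hbeq
        have hsub : Subsingleton (M ⧸ Q) := (Nat.card_eq_one_iff_unique.mp hbeq).1
        exact hx₀ ((Submodule.Quotient.mk_eq_zero Q).mp (Subsingleton.elim _ _))
      · rw [hbeq] at hQle ⊢
        have hb0 : b = 0 := by
          by_contra hb0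
          have : p ^ 2 ≤ p ^ (b + 1) := Nat.pow_le_pow_right hp.out.pos (by omega)
          have hp2 : p < p ^ 2 := by
            calc p = p ^ 1 := (pow_one p).symm
              _ < p ^ 2 := Nat.pow_lt_pow_right hp.out.one_lt (by norm_num)
          omega
        rw [hb0, zero_add, pow_one]
    have hgenQ : ∀ y : M, ∃ n : ℤ, y - n • x₀ ∈ Q := by
      intro y
      have hxbar : Q.mkQ x₀ ≠ 0 := fun h => hx₀ ((Submodule.Quotient.mk_eq_zero Q).mp h)
      have hord : addOrderOf (Q.mkQ x₀) = p := by
        have hdvd : addOrderOf (Q.mkQ x₀) ∣ p := by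
          rw [← hcardQ]; exact addOrderOf_dvd_natCard _
        rcases (Nat.dvd_prime hp.out).mp hdvd with h | h
        · exact absurd (AddMonoid.addOrderOf_eq_one_iff.mp h) hxbar
        · exact h
      have htop : AddSubgroup.zmultiples (Q.mkQ x₀) = ⊤ := by
        apply AddSubgroup.eq_top_of_card_eq
        rw [Nat.card_zmultiples, hord, hcardQ]
      have hy : Q.mkQ y ∈ AddSubgroup.zmultiples (Q.mkQ x₀) := by
        rw [htop]; exact AddSubgroup.mem_top _
      obtain ⟨n, hn⟩ := AddSubgroup.mem_zmultiples_iff.mp hy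
      refine ⟨n, ?_⟩
      rw [← Submodule.ker_mkQ Q, LinearMap.mem_ker, map_sub, map_zsmul, ← hn, sub_self]
    obtain ⟨R₀, hR₀, hR₀φ⟩ := hrange x₀
    have htop : (⊤ : Submodule ℤ M) ≤ R₀ ⊔ ((⊤ : Submodule ℤ M).map π ⊔ (⊤ : Submodule ℤ M).map T) := by
      intro y _
      obtain ⟨n, hn⟩ := hgenQ y
      have hy : y = n • x₀ + (y - n • x₀) := by abel
      rw [hy]
      refine Submodule.add_mem_sup ((hR₀ _).mpr ⟨C n, ?_⟩) hn
      rw [aeval_C, algebraMap_int_eq, eq_intCast, Module.End.intCast_apply]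
    have hMR₀ : (⊤ : Submodule ℤ M) ≤ R₀ :=
      le_of_le_sup_smul_sup_sub_one ⟨a, ha⟩ φ hφ (fun _ _ => Submodule.mem_top) hR₀φ htop
    refine ⟨x₀, fun y => (hR₀ y).mp (hMR₀ Submodule.mem_top), ?_⟩
    -- `ν₁M = 𝔪M ∋ p x₀`
    have hVQ' : V = Q := by
      refine eq_of_le_of_card_quotient_le hVQ ?_
      rw [hcardQ]; exact h1
    rw [hVQ']
    exact Submodule.mem_sup_left ⟨x₀, Submodule.mem_top, rfl⟩

/-! ## §2 The elementary-layer lemma for the layers `M/ν_kTM` -/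

/-- TRANSPORT ALONG THE GENERATOR: if every element of `M` is `f(φ)·x₀`, `ψ` commutes with `φ`, `S` is stable under every `f(φ)`, and `ψ x₀ ∈ S`,
then `ψM ⊆ S`. [folklore] -/
private theorem map_top_le_of_generator {φ ψ : Module.End ℤ M} {x₀ : M} (hgen : ∀ y : M, ∃ f : ℤ[X], aeval φ f x₀ = y)
    (hψ : Commute ψ φ) {S : Submodule ℤ M} (hS : ∀ (f : ℤ[X]), ∀ w ∈ S, aeval φ f w ∈ S) (hx : ψ x₀ ∈ S) :
    (⊤ : Submodule ℤ M).map ψ ≤ S := by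
  rintro _ ⟨y, -, rfl⟩
  obtain ⟨f, rfl⟩ := hgen y
  rw [← Module.End.mul_apply, (commute_aeval_of_commute hψ f).eq, Module.End.mul_apply]
  exact hS f _ hx

/-- `T^jM ⊆ T^iM` for `i ≤ j`. [folklore] -/
private theorem map_top_pow_le_of_le (T : Module.End ℤ M) {i j : ℕ} (h : i ≤ j) :
    (⊤ : Submodule ℤ M).map (T ^ j) ≤ (⊤ : Submodule ℤ M).map (T ^ i) := by
  obtain ⟨l, rfl⟩ := Nat.exists_eq_add_of_le h
  rw [pow_add, Module.End.mul_eq_comp, Submodule.map_comp]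
  exact Submodule.map_mono le_top

/-- `T^{p^k}M ⊆ ν_kTM + T(pM)` and `ν_kTM ⊆ T^{p^k}M + pM`, elementwise: `ν_kT w = T^{p^k} w + p·R_k(φ)·T w`.
[cite: Washington1997, §13.3 Prop. 13.23 (proof: `ν_n ≡ T^{p^n−1} mod p`)] -/
private theorem exists_geom_sum_mul_sub_one_apply_eq [hp : Fact p.Prime] (φ : Module.End ℤ M) (k : ℕ) :
    ∃ R : ℤ[X], ∀ w : M, ((∑ i ∈ range (p ^ k), φ ^ i) * (φ - 1)) w =
      ((φ - 1) ^ p ^ k) w + ((p : ℤ) • (1 : Module.End ℤ M)) ((φ - 1) (aeval φ R w)) := by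
  obtain ⟨R, hR⟩ := MuZeroRank.exists_geom_sum_eq_X_sub_one_pow_add p k
  refine ⟨R, fun w => ?_⟩
  have hν : (∑ i ∈ range (p ^ k), φ ^ i) = (φ - 1) ^ (p ^ k - 1) + ((p : ℤ) • (1 : Module.End ℤ M)) * aeval φ R := by
    have h := congrArg (aeval φ) hR
    rw [map_sum, map_add, map_pow, map_mul, aeval_C, algebraMap_int_eq, eq_intCast, aeval_X_sub_one] at h
    simp only [map_pow, aeval_X] at h
    rw [h, smul_mul_assoc, one_mul, zsmul_eq_mul]
  have hcomm : Commute (aeval φ R) (φ - 1) :=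
    ((commute_aeval_of_commute (Commute.refl φ) R).symm.sub_right (Commute.one_right _))
  have hpk : p ^ k - 1 + 1 = p ^ k := Nat.sub_add_cancel (Nat.one_le_pow _ _ hp.out.pos)
  rw [hν, add_mul, ← pow_succ, hpk, LinearMap.add_apply, Module.End.mul_apply, Module.End.mul_apply, ← Module.End.mul_apply (aeval φ R),
    hcomm.eq, Module.End.mul_apply]

/-- ★★ **THE ELEMENTARY-LAYER LEMMA, `Y₀ = TM` shape.**  `M` a finite abelian group of `p`-power order, `φ ∈ End(M)` with `φ^{p^t} = 1`, `T = φ − 1`,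
`ν_k = ∑_{i<p^k} φ^i`.  IF `#(M/TM) ≤ p` AND `#(M/(ν_kTM + pM)) < #(M/ν_kTM)` (the quotient `M/ν_kTM` is NOT killed by `p`), THEN **`#(M/pM) ≤ p^{p^k − 1}`**.
In the Fukuda package over a base with `ord_p h_K = 1` and maximal unit norm index (`Y₀ = TA`) this reads: `Cl(K_k)[p^∞]` NOT elementary abelian ⟹
`rank_p Cl(K_j) ≤ p^k − 1` at every layer of the package.  Proof: §1 generator with `p x₀ ∈ TM`; climb `pM ⊆ T^jM` while `T^jM ⊄ pM` (`p x₀ = T^j f(φ)x₀`: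
`p ∤ f(1)` would give `T^jM ⊆ pM`); `pM ⊆ T^{p^k}M ⊆ ν_kTM + T·pM` is excluded by Nakayama. [cite: Washington1997, §13.3 Lemmas 13.15, 13.18 and Prop. 13.22–13.23]
[cite: Fukuda1994, Thm. 1 (proof, p. 264)] [cite: Lang1990, Ch. 5 §2 (Weierstrass preparation)] -/
theorem card_quotient_smul_le_of_card_quotient_sub_one_le [Finite M] [hp : Fact p.Prime] (hM : ∃ a : ℕ, Nat.card M = p ^ a)
    (φ : Module.End ℤ M) {t : ℕ} (hφ : φ ^ p ^ t = 1)
    (h1 : Nat.card (M ⧸ (⊤ : Submodule ℤ M).map (φ - 1)) ≤ p) {k : ℕ}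
    (hk : Nat.card (M ⧸ ((⊤ : Submodule ℤ M).map ((∑ i ∈ range (p ^ k), φ ^ i) * (φ - 1)) ⊔
        (⊤ : Submodule ℤ M).map ((p : ℤ) • (1 : Module.End ℤ M)))) <
      Nat.card (M ⧸ (⊤ : Submodule ℤ M).map ((∑ i ∈ range (p ^ k), φ ^ i) * (φ - 1)))) :
    Nat.card (M ⧸ (⊤ : Submodule ℤ M).map ((p : ℤ) • (1 : Module.End ℤ M))) ≤ p ^ (p ^ k - 1) := by
  classical
  set π : Module.End ℤ M := (p : ℤ) • 1 with hπ
  set T : Module.End ℤ M := φ - 1 with hT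
  set P : Submodule ℤ M := (⊤ : Submodule ℤ M).map π with hP
  set W : Submodule ℤ M := (⊤ : Submodule ℤ M).map ((∑ i ∈ range (p ^ k), φ ^ i) * T) with hW
  have hp1 : 1 < p := hp.out.one_lt
  have hπapp : ∀ x : M, π x = (p : ℤ) • x := fun x => rfl
  -- ### commuting and stability facts
  have hTφ : Commute T φ := commute_sub_one_self φ
  have hπφ : Commute π φ := (Commute.one_left φ).smul_left _
  have hcommT : ∀ f : ℤ[X], Commute (aeval φ f) T := fun f =>
    ((commute_aeval_of_commute (Commute.refl φ) f).symm.sub_right (Commute.one_right _) : Commute (aeval φ f) (φ - 1))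
  have hπT : Commute π T := (Commute.one_left T).smul_left _
  have hmemP : ∀ x : M, (p : ℤ) • x ∈ P := fun x => ⟨x, Submodule.mem_top, rfl⟩
  have hPall : ∀ (ψ : Module.End ℤ M), ∀ w ∈ P, ψ w ∈ P := fun ψ w hw => apply_mem_map_top_smul ψ hw
  have hPφ : ∀ w ∈ P, φ w ∈ P := hPall φ
  have hPpow : ∀ (i : ℕ), P.map (T ^ (i + 1)) ≤ P.map T := by
    intro i
    rw [pow_succ', Module.End.mul_eq_comp, Submodule.map_comp]
    exact Submodule.map_mono (by rintro _ ⟨w, hw, rfl⟩; exact hPall _ w hw)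
  have hPmap_le : P.map T ≤ P.map π ⊔ P.map T := le_sup_right
  have htopφ : ∀ (i : ℕ), ∀ w ∈ (⊤ : Submodule ℤ M).map (T ^ i), φ w ∈ (⊤ : Submodule ℤ M).map (T ^ i) :=
    fun i w hw => apply_mem_map_top_of_commute (hTφ.pow_left i).symm hw
  have hνφ : Commute ((∑ i ∈ range (p ^ k), φ ^ i) * T) φ :=
    (Commute.sum_left _ _ _ fun i _ => Commute.pow_left (Commute.refl φ) i).mul_left hTφ
  have hWφ : ∀ w ∈ W, φ w ∈ W := fun w hw => apply_mem_map_top_of_commute hνφ.symm hw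
  -- ### `pM ⊄ ν_kTM`
  have hPW : ¬ P ≤ W := by
    intro hle
    rw [sup_eq_left.mpr hle] at hk
    exact lt_irrefl _ hk
  -- ### the generator with `p x₀ ∈ TM`, hence `pM ⊆ TM`
  obtain ⟨x₀, hgen, hpx₀⟩ := exists_generator_of_le hM φ hφ (V := (⊤ : Submodule ℤ M).map T) le_sup_right h1
  have hPT : P ≤ (⊤ : Submodule ℤ M).map (T ^ 1) := by
    rw [pow_one]
    exact map_top_le_of_generator hgen hπφ (fun f w hw => apply_mem_map_top_of_commute (hcommT f) hw) hpx₀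
  -- `#(M/(TM + P)) ≤ p` and the count
  have hQ : Nat.card (M ⧸ (LinearMap.range T ⊔ P)) ≤ p :=
    le_trans (MuZeroRank.card_quotient_le_of_le (by rw [← Submodule.map_top]; exact le_sup_left)) h1
  have hcount : ∀ d : ℕ, (⊤ : Submodule ℤ M).map (T ^ d) ≤ P → Nat.card (M ⧸ P) ≤ p ^ d := by
    intro d hd
    have h := card_quotient_range_pow_sup_le_pow T P (hPall T) d
    rw [← Submodule.map_top, sup_eq_right.mpr hd] at h
    exact h.trans (Nat.pow_le_pow_left hQ d)
  -- ### the climb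
  obtain ⟨E, hE⟩ := exists_sub_one_pow_eq_smul_aeval φ hφ
  have hex : ∃ j : ℕ, (⊤ : Submodule ℤ M).map (T ^ j) ≤ P := by
    refine ⟨p ^ t, ?_⟩
    rintro _ ⟨w, -, rfl⟩
    rw [hT, hE, LinearMap.smul_apply]
    exact hmemP _
  set d := Nat.find hex with hd
  have hdspec : (⊤ : Submodule ℤ M).map (T ^ d) ≤ P := Nat.find_spec hex
  have hdmin : ∀ j, j < d → ¬ (⊤ : Submodule ℤ M).map (T ^ j) ≤ P := fun j hj => Nat.find_min hex hj
  have hclimb : ∀ j, 1 ≤ j → j ≤ d → P ≤ (⊤ : Submodule ℤ M).map (T ^ j) := by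
    intro j hj
    induction j, hj using Nat.le_induction with
    | base => intro _; exact hPT
    | succ j hj ih =>
      intro hjd
      have hPj := ih (Nat.le_of_succ_le hjd)
      obtain ⟨w, -, hw⟩ := Submodule.mem_map.mp (hPj (hmemP x₀))
      obtain ⟨f, rfl⟩ := hgen w
      by_cases hfc : (p : ℤ) ∣ f.eval 1
      · obtain ⟨c'', hc''⟩ := hfc
        obtain ⟨f', hf'⟩ := exists_eq_C_eval_add_X_sub_one_mul f
        have hstep : π x₀ ∈ P.map (T ^ j) ⊔ (⊤ : Submodule ℤ M).map (T ^ (j + 1)) := by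
          have hFx : aeval φ f x₀ = (f.eval 1) • x₀ + T (aeval φ f' x₀) := by
            conv_lhs => rw [hf']
            rw [map_add, map_mul, aeval_C, algebraMap_int_eq, eq_intCast, aeval_X_sub_one, LinearMap.add_apply,
              Module.End.intCast_apply, Module.End.mul_apply]
          rw [hπapp, ← hw, hFx, map_add]
          refine Submodule.add_mem_sup ⟨(f.eval 1) • x₀, ?_, rfl⟩ ⟨aeval φ f' x₀, Submodule.mem_top, ?_⟩
          · rw [hc'', mul_comm, mul_smul]; exact P.smul_mem _ (hmemP x₀)
          · rw [pow_succ, Module.End.mul_apply]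
        have hle : P ≤ P.map (T ^ j) ⊔ (⊤ : Submodule ℤ M).map (T ^ (j + 1)) := by
          refine map_top_le_of_generator hgen hπφ (fun f'' u hu => ?_) hstep
          obtain ⟨u₁, hu₁, u₂, hu₂, rfl⟩ := Submodule.mem_sup.mp hu
          rw [map_add]
          exact Submodule.add_mem_sup (apply_mem_map_of_commute ((hcommT f'').pow_right j) (hPall _) hu₁)
            (apply_mem_map_top_of_commute ((hcommT f'').pow_right (j + 1)) hu₂)
        refine le_of_le_sup_smul_sup_sub_one hM φ hφ hPφ (htopφ (j + 1)) (hle.trans ?_)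
        rw [sup_comm]
        refine sup_le_sup_left ?_ _
        obtain ⟨q, hq⟩ : ∃ q, j = q + 1 := ⟨j - 1, by omega⟩
        rw [hq]
        exact (hPpow q).trans hPmap_le
      · exfalso
        have hFunit : IsUnit (aeval φ f) := isUnit_aeval_of_not_dvd_eval hM φ hφ hfc
        set Fi : Module.End ℤ M := ↑(hFunit.unit⁻¹) with hFi
        have hFiF : Fi * aeval φ f = 1 := by rw [hFi]; exact hFunit.unit.inv_mul
        have hFT : Commute (aeval φ f) T := hcommT f
        have hTjx : (T ^ j) x₀ ∈ P := by
          have h1' : (T ^ j) x₀ = Fi (π x₀) := by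
            rw [hπapp, ← hw]
            show (T ^ j) x₀ = (Fi * (T ^ j * aeval φ f)) x₀
            rw [(hFT.pow_right j).symm.eq, ← mul_assoc, hFiF, one_mul]
          rw [h1']; exact hPall Fi _ (hmemP x₀)
        exact hdmin j (Nat.lt_of_succ_le hjd)
          (map_top_le_of_generator hgen ((hTφ.pow_left j)) (fun f'' u hu => hPall _ u hu) hTjx)
  -- ### `d ≥ p^k` is impossible: `pM ⊆ T^{p^k}M ⊆ ν_kTM + T·pM`
  have hdlt : d < p ^ k := by
    by_contra hge
    push Not at hge
    have hm1 : 1 ≤ p ^ k := Nat.one_le_pow _ _ hp.out.pos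
    have hPm : P ≤ (⊤ : Submodule ℤ M).map (T ^ p ^ k) := hclimb _ hm1 hge
    obtain ⟨Rk, hRk⟩ := exists_geom_sum_mul_sub_one_apply_eq (p := p) φ k
    have hTm : (⊤ : Submodule ℤ M).map (T ^ p ^ k) ≤ W ⊔ (P.map π ⊔ P.map T) := by
      rintro _ ⟨w, -, rfl⟩
      have hw : (T ^ p ^ k) w = ((∑ i ∈ range (p ^ k), φ ^ i) * T) w - π (T (aeval φ Rk w)) := by
        rw [hRk w, add_sub_cancel_right]
      rw [hw]
      refine Submodule.sub_mem _ (Submodule.mem_sup_left ⟨w, Submodule.mem_top, rfl⟩)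
        (Submodule.mem_sup_right (Submodule.mem_sup_right ⟨π (aeval φ Rk w), hmemP _, ?_⟩))
      show (T * π) (aeval φ Rk w) = (π * T) (aeval φ Rk w)
      rw [hπT.eq]
    exact hPW (le_of_le_sup_smul_sup_sub_one hM φ hφ hPφ hWφ (hPm.trans hTm))
  -- ### conclusion
  exact (hcount d hdspec).trans (Nat.pow_le_pow_right hp.out.pos (by omega))

/-! ## §3 The rank bounds `r_k ≤ p^k`, and the small-rank side with threshold `p^k` -/

/-- **`#(M/TM) ≤ p ⟹ #(M/(ν_kTM + pM)) ≤ p^{p^k}`** (the layers `M/ν_kTM` have `p`-rank `≤ p^k`): `ν_kTM + pM ⊇ T^{p^k}M + pM` and the filtration count.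
[cite: Washington1997, §13.3 Prop. 13.23 (proof)] -/
theorem card_quotient_sup_sub_one_le_pow [Finite M] [hp : Fact p.Prime] (φ : Module.End ℤ M)
    (h1 : Nat.card (M ⧸ (⊤ : Submodule ℤ M).map (φ - 1)) ≤ p) (k : ℕ) :
    Nat.card (M ⧸ ((⊤ : Submodule ℤ M).map ((∑ i ∈ range (p ^ k), φ ^ i) * (φ - 1)) ⊔
        (⊤ : Submodule ℤ M).map ((p : ℤ) • (1 : Module.End ℤ M)))) ≤ p ^ (p ^ k) := by
  set π : Module.End ℤ M := (p : ℤ) • 1 with hπ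
  set T : Module.End ℤ M := φ - 1 with hT
  set P : Submodule ℤ M := (⊤ : Submodule ℤ M).map π with hP
  set W : Submodule ℤ M := (⊤ : Submodule ℤ M).map ((∑ i ∈ range (p ^ k), φ ^ i) * T) with hW
  obtain ⟨R, hR⟩ := exists_geom_sum_mul_sub_one_apply_eq (p := p) φ k
  have hle : LinearMap.range (T ^ p ^ k) ⊔ P ≤ W ⊔ P := by
    refine sup_le ?_ le_sup_right
    rintro _ ⟨w, rfl⟩
    have hw : (T ^ p ^ k) w = ((∑ i ∈ range (p ^ k), φ ^ i) * T) w - π (T (aeval φ R w)) := by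
      rw [hR w, add_sub_cancel_right]
    rw [hw]
    exact Submodule.sub_mem _ (Submodule.mem_sup_left ⟨w, Submodule.mem_top, rfl⟩)
      (Submodule.mem_sup_right ⟨T (aeval φ R w), Submodule.mem_top, rfl⟩)
  have hQ : Nat.card (M ⧸ (LinearMap.range T ⊔ P)) ≤ p :=
    le_trans (MuZeroRank.card_quotient_le_of_le (by rw [← Submodule.map_top]; exact le_sup_left)) h1
  have hPT : ∀ w ∈ P, T w ∈ P := fun w hw => apply_mem_map_top_smul T hw
  calc Nat.card (M ⧸ (W ⊔ P)) ≤ Nat.card (M ⧸ (LinearMap.range (T ^ p ^ k) ⊔ P)) := MuZeroRank.card_quotient_le_of_le hle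
    _ ≤ Nat.card (M ⧸ (LinearMap.range T ⊔ P)) ^ (p ^ k) := card_quotient_range_pow_sup_le_pow T P hPT _
    _ ≤ p ^ (p ^ k) := Nat.pow_le_pow_left hQ _

/-- ★ **The small-rank side with threshold `p^k`**: `#(M/TM) ≤ p` and `#(M/(ν_kTM + pM)) < p^{p^k}` ⟹ **`#(M/pM) ≤ p^{p^k−1}`** — `T^{p^k}M + pM ⊇ ν_kTM + pM`
has index `< p^{p^k}`, so the strict filtration `T^iM + pM` reaches `pM` before step `p^k` (tree `MuZeroRank.card_quotient_smul_le_pow`), and each graded piece has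
order `≤ #(M/(TM + pM)) ≤ p`.  (L10's threshold `p^k − 1` is what survives when `Y₀` is only known to lie between `TM` and `M`.)
[cite: Washington1997, §13.3 Prop. 13.23 (proof)] [cite: Fukuda1994, Thm. 1 (2), p. 264] -/
theorem card_quotient_smul_le_of_card_quotient_sup_lt_pow [Finite M] [hp : Fact p.Prime] (φ : Module.End ℤ M) {t : ℕ}
    (hφ : φ ^ p ^ t = 1) (h1 : Nat.card (M ⧸ (⊤ : Submodule ℤ M).map (φ - 1)) ≤ p) {k : ℕ}
    (hk : Nat.card (M ⧸ ((⊤ : Submodule ℤ M).map ((∑ i ∈ range (p ^ k), φ ^ i) * (φ - 1)) ⊔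
        (⊤ : Submodule ℤ M).map ((p : ℤ) • (1 : Module.End ℤ M)))) < p ^ (p ^ k)) :
    Nat.card (M ⧸ (⊤ : Submodule ℤ M).map ((p : ℤ) • (1 : Module.End ℤ M))) ≤ p ^ (p ^ k - 1) := by
  set π : Module.End ℤ M := (p : ℤ) • 1 with hπ
  set T : Module.End ℤ M := φ - 1 with hT
  obtain ⟨R, hR⟩ := exists_geom_sum_mul_sub_one_apply_eq (p := p) φ k
  obtain ⟨E, hE⟩ := exists_sub_one_pow_eq_smul_aeval φ hφ
  -- `ν_kTM + pM ⊆ T^{p^k}M + pM`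
  have hle : (⊤ : Submodule ℤ M).map ((∑ i ∈ range (p ^ k), φ ^ i) * T) ⊔ (⊤ : Submodule ℤ M).map π ≤
      LinearMap.range (T ^ p ^ k) ⊔ LinearMap.range π := by
    refine sup_le ?_ (by rw [Submodule.map_top]; exact le_sup_right)
    rintro _ ⟨w, -, rfl⟩
    rw [hR w]
    exact Submodule.add_mem_sup ⟨w, rfl⟩ ⟨T (aeval φ R w), rfl⟩
  have hlt : Nat.card (M ⧸ (LinearMap.range (T ^ p ^ k) ⊔ LinearMap.range π)) < p ^ (p ^ k) :=
    lt_of_le_of_lt (MuZeroRank.card_quotient_le_of_le hle) hk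
  have hN : ∃ N : ℕ, LinearMap.range (T ^ N) ≤ LinearMap.range π := by
    refine ⟨p ^ t, ?_⟩
    rintro _ ⟨w, rfl⟩
    refine ⟨aeval φ E w, ?_⟩
    rw [hT, hE, LinearMap.smul_apply, LinearMap.smul_apply, Module.End.one_apply]
  have h := MuZeroRank.card_quotient_smul_le_pow T hN (Nat.one_le_pow _ _ hp.out.pos) hlt
  have hQ : Nat.card (M ⧸ (LinearMap.range T ⊔ LinearMap.range π)) ≤ p :=
    le_trans (MuZeroRank.card_quotient_le_of_le (by rw [← Submodule.map_top]; exact le_sup_left)) h1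
  rw [Submodule.map_top]
  exact h.trans (Nat.pow_le_pow_left hQ _)

end Module

end Literature.NumberTheory.IwasawaTheory.FukudaElementary

end
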